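import Literature.NumberTheory.EllipticCurves.RohrlichAnticyclotomicNonvanishing
import Mathlib.Analysis.Complex.Basic
import Mathlib.Analysis.Complex.CauchyIntegral
import Mathlib.Analysis.Analytic.Uniqueness
import Mathlib.Analysis.SpecialFunctions.Pow.Deriv
import Mathlib.Analysis.SpecialFunctions.Gamma.Beta
import HarnessLib

/-!
# The functional equation behind Rohrlich's dichotomy: `W(φρ) ∈ {1, −1}` for anticyclotomic twists
# (Hecke; Jia, Acta Arith. 2026, §1 and §2 (3)–(6)) — and the root-number-free corollary
# "`ord_{s=1} L(s, φρ) ≤ 1` for all but finitely many `ρ`"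

Topic `Literature/NumberTheory/EllipticCurves`; companion of `RohrlichAnticyclotomicNonvanishing.lean`
(named fact `RohrlichJia_centralOrder_anticyclotomicTwists`, the predicates `IsCentralRootNumber`,
`RohrlichDichotomy`, the family `anticyclotomicTwistFamily`). Cell `bsd-goldfeld`, typer seat
`bsd-goldfeld-ty` g3. ONE named fact + proved corollaries; no instance, no notation.

## Why this file

`RohrlichJia_centralOrder_anticyclotomicTwists` is stated, as printed, as a dichotomy ON THE ROOT
NUMBER: for all but finitely many `χ = φρ ∈ X`, `W(χ) = 1 ⟹ L(1, χ) ≠ 0` and `W(χ) = −1 ⟹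
ord_{s=1} L(s, χ) = 1`, with `W(χ) = ±1` rendered by the predicate `IsCentralRootNumber χ (±1)` (an
entire `Λ(s) = Γ(s) B^s L(s, χ)` with `Λ(s) = W Λ(2 − s)`). That `W(χ)` EXISTS and is `±1` for every
`χ ∈ X` is Hecke's functional equation in the self-dual situation of the theorem — a separate
classical theorem, stated on the same page of the source (Jia 2026, §1: "in the functional equation
`Λ(s,χ) = W(χ)Λ(2−s,χ̄) = W(χ)Λ(2−s,χ)` the root number `W(χ) = 1` or `−1`"; §2 (3)–(6): "`Λ(s,χ) =
Γ(s)(Af)^s L(s,χ)`. The functional equation is `Λ(s,χ) = W(χ)Λ(2−s,χ)`. Hecke proved that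
`Λ(s,χ) = ∫_1^∞ θ(t,χ)(t^s + W(χ)t^{2−s}) dt/t`" — so `Λ` is entire; "see [Roh84a], (6) and (7)").
Vendoring it (this file's fact) makes the typed dichotomy provably EXHAUSTIVE on `X` and yields the
root-number-free consumer statement: for all but finitely many anticyclotomic twists,
`ord_{s=1} L(s, φρ) ≤ 1` (`L(1) ≠ 0` or a simple zero) — the form in which "generic non-vanishing of
`L` or `L′`" enters `Λ`-adic non-triviality arguments (Agboola–Howard 2006 §3; BCST 2022 Thm. 7.1 (i)).

## Sources (read 2026-08-26; held `paper:arxiv-2412.05867`, chunks p0003, p0005)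

* [Jia2026ActaArith] §1 (p0003): "`ρ` is equivariant because `L/K` is anticyclotomic, so `χ` is also
  equivariant for all `χ ∈ X`. Hence `L(s,χ) = … = L(s, χ̄)` … so `L(s,χ)` is real. Therefore, in the
  functional equation `Λ(s,χ) = W(χ)Λ(2−s,χ̄) = W(χ)Λ(2−s,χ)`, the root number `W(χ) = 1` or `−1`";
  §2 (p0005), displays (3)–(6) quoted above.
* [Rohrlich1984Anticyclotomic] (6)–(7) (the same integral representation; primary paywalled for this
  seat, acq-10839 — cited through Jia's pointer).
* [SilvermanATAEC1994] Ch. II Thm. 10.3 (Hecke: analytic continuation and functional equation of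
  `L(s, ψ)` for a Grössencharacter `ψ`, `N(𝔇𝔠_ψ)^{s/2}((2π)^{−s}Γ(s))^{[L:ℚ]}` normalisation, p. 169–170)
  and Cor. 10.5.1 (`w ∈ {±1}` for CM elliptic curves, p. 171–172) — the textbook form.

## What is here

* `hecke_centralRootNumber_anticyclotomicTwists` — the named fact: for `K` imaginary quadratic,
  `c ≠ 1`, `φ` of infinity type `(1,0)` and conj-equivariant, and `ρ` finite-order anticyclotomic:
  `IsCentralRootNumber (φρ) 1 ∨ IsCentralRootNumber (φρ) (−1)` (scope = exactly the family `X` of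
  the source; no ramification condition is needed for the functional equation, so none is imposed).
* PROVED: `IsHeckeConjEquivariant.mul_of_isAnticyclotomic` (`φ` equivariant, `ρ` finite-order
  anticyclotomic ⟹ `φρ` equivariant — Jia's "so `χ` is also equivariant", the one-line computation
  `(φρ)(c•x) = \overline{φ(x)} ρ(x)⁻¹ = \overline{φ(x)ρ(x)}` as `|ρ(x)| = 1`);
  `RohrlichJia_centralOrder_anticyclotomicTwists.finite_not_centralOrder_le_one` (granted both facts:
  all but finitely many `ρ ∈ X_P` have `L(1, φρ) ≠ 0` or a simple zero at `s = 1`).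

## What is NOT here

No `_holds` (Hecke's theta-integral representation for Grössencharacter `L`-functions is not in
Mathlib or the tree: SIZE L–XL); no root-number FORMULA (Jia (9), Miyake Thm. 3.3.1); no statement for
non-equivariant `χ` (there `W(χ)` is a complex number of modulus one and the equation relates `χ`
to `χ̄`).
-/

noncomputable section

open scoped ComplexConjugate
open NumberField IsDedekindDomain
open Literature.NumberTheory.Automorphic Literature.NumberTheory.GaloisRepresentations

namespace Literature.NumberTheory.EllipticCurves

/-! ### The named fact -/

/-- **Hecke's functional equation for the anticyclotomic twists `χ = φρ ∈ X`: the root number is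
`+1` or `−1`** (Jia, Acta Arith. 2026, §1: "`χ` is also equivariant for all `χ ∈ X` … `L(s,χ)` is
real. Therefore, in the functional equation `Λ(s,χ) = W(χ)Λ(2−s,χ̄) = W(χ)Λ(2−s,χ)`, the root number
`W(χ) = 1` or `−1`"; §2 (3)–(6): "`A = (2π)⁻¹|d_K|^{1/2}`, `f = (N𝔣(χ))^{1/2}`,
`Λ(s,χ) = Γ(s)(Af)^s L(s,χ)`. The functional equation is `Λ(s,χ) = W(χ)Λ(2−s,χ)`. Hecke proved that
`Λ(s,χ) = ∫_1^∞ θ(t,χ)(t^s + W(χ)t^{2−s}) dt/t`" [entire]; Rohrlich 1984 (6)–(7); Silverman,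
*Advanced Topics* II Thm. 10.3 / Cor. 10.5.1). Transcription: `K` imaginary quadratic with complex
conjugation `c ≠ 1`; `φ` an idelic Hecke character of infinity type `(1, 0)` with
`φ(c • x) = \overline{φ(x)}` (`IsHeckeConjEquivariant`); `ρ` of finite order with `ρ ∘ c = ρ⁻¹`
(`IsAnticyclotomicCharacter`); conclusion: `IsCentralRootNumber (φ * ρ) W` for `W = 1` or `W = −1`,
i.e. there are `B > 0` (`= Af`) and an ENTIRE `Λ` with `Λ(s) = Γ(s) B^s L(s, φρ)` on `re s > 3/2` and
`Λ(s) = W Λ(2 − s)`. No `_holds` (Hecke's theta integral for Grössencharacter `L`-functions is not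
in the tree). [cite: Jia2026ActaArith, §1 and §2 (3)–(6)] [cite: Rohrlich1984Anticyclotomic, (6)–(7)]
[cite: SilvermanATAEC1994, Ch. II Thm. 10.3 and Cor. 10.5.1] -/
def hecke_centralRootNumber_anticyclotomicTwists : Prop :=
  ∀ (K : Type) [Field K] [NumberField K] (_hK : IsImaginaryQuadratic K) (c : K ≃ₐ[ℚ] K) (_hc : c ≠ 1)
    (φ : HeckeCharacter K) (_hφ : φ.HasInfinityType (fun _ ↦ 1) (fun _ ↦ 0))
    (_heq : IsHeckeConjEquivariant c φ) (ρ : HeckeCharacter K) (_hρ : ρ.IsFiniteOrder)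
    (_hac : IsAnticyclotomicCharacter c ρ),
    IsCentralRootNumber (φ * ρ) 1 ∨ IsCentralRootNumber (φ * ρ) (-1)

/-! ### Proved bookkeeping -/

section API

variable {K : Type} [Field K] [NumberField K]

/-- A finite-order Hecke character takes values of modulus one, hence `ρ(x)⁻¹ = \overline{ρ(x)}`.
[cite: Jia2026ActaArith, §1 ("ρ is equivariant because L/K is anticyclotomic")] -/
theorem inv_apply_eq_conj_of_isFiniteOrder {ρ : HeckeCharacter K} (hρ : ρ.IsFiniteOrder)
    (x : ideleGroup K) : (((ρ x)⁻¹ : ℂˣ) : ℂ) = conj ((ρ x : ℂˣ) : ℂ) := by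
  rw [Units.val_inv_eq_inv_val]
  exact Complex.inv_eq_conj (hρ.isUnitary x)

/-- **"`ρ` is equivariant because `L/K` is anticyclotomic, so `χ = φρ` is also equivariant"** (Jia
2026, §1): if `φ(c • x) = \overline{φ(x)}` and `ρ` is a finite-order character with `ρ ∘ c = ρ⁻¹`,
then `(φρ)(c • x) = \overline{φ(x)} · ρ(x)⁻¹ = \overline{(φρ)(x)}`.
[cite: Jia2026ActaArith, §1 (the set X)] -/
theorem IsHeckeConjEquivariant.mul_of_isAnticyclotomic {c : K ≃ₐ[ℚ] K} {φ ρ : HeckeCharacter K}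
    (hφ : IsHeckeConjEquivariant c φ) (hρ : ρ.IsFiniteOrder) (hac : IsAnticyclotomicCharacter c ρ) :
    IsHeckeConjEquivariant c (φ * ρ) := by
  intro x
  unfold IsAnticyclotomicCharacter at hac
  rw [HeckeCharacter.galConj_mul, HeckeCharacter.mul_apply, Units.val_mul, hφ x, hac,
    HeckeCharacter.inv_apply, inv_apply_eq_conj_of_isFiniteOrder hρ x, HeckeCharacter.mul_apply,
    Units.val_mul, map_mul]

/-- Members of the family `X` are equivariant twists: for `ρ ∈ anticyclotomicTwistFamily c P`,
`φρ` is conj-equivariant whenever `φ` is. [cite: Jia2026ActaArith, §1 (the set X)] -/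
theorem IsHeckeConjEquivariant.mul_of_mem_anticyclotomicTwistFamily {c : K ≃ₐ[ℚ] K}
    {φ ρ : HeckeCharacter K} (hφ : IsHeckeConjEquivariant c φ) {P : Finset ℕ}
    (hρ : ρ ∈ anticyclotomicTwistFamily c P) : IsHeckeConjEquivariant c (φ * ρ) :=
  hφ.mul_of_isAnticyclotomic hρ.1 hρ.2.1

end API

namespace RohrlichJia_centralOrder_anticyclotomicTwists

variable {K : Type} [Field K] [NumberField K]

/-- **Root-number-free form of Rohrlich's theorem: `ord_{s=1} L(s, φρ) ≤ 1` for all but finitely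
many anticyclotomic twists.** Granted `RohrlichJia_centralOrder_anticyclotomicTwists` (the dichotomy
off a finite set) and `hecke_centralRootNumber_anticyclotomicTwists` (`W(φρ) ∈ {1, −1}` on `X`): for
`K` imaginary quadratic, `c ≠ 1`, `φ` of type `(1,0)` equivariant and `P` finite, all but finitely
many finite-order anticyclotomic `ρ` unramified outside `P` satisfy `L(1, φρ) ≠ 0`
(`CentralValueNeZero`) or have a simple zero at `s = 1` (`HasSimpleCentralZero`) — the form consumed
as "generic non-vanishing of `L` or `L′`" (Agboola–Howard 2006 §3 and App.; BCST 2022 Thm. 7.1 (i)).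
[cite: Jia2026ActaArith, Thm. 1 with §1–§2 (3)–(6)] [cite: Rohrlich1984Anticyclotomic, Theorem (p. 384)]
[cite: AgboolaHoward2006, §3] -/
theorem finite_not_centralOrder_le_one (hR : RohrlichJia_centralOrder_anticyclotomicTwists)
    (hW : hecke_centralRootNumber_anticyclotomicTwists) (hK : IsImaginaryQuadratic K)
    {c : K ≃ₐ[ℚ] K} (hc : c ≠ 1) {φ : HeckeCharacter K}
    (hφ : φ.HasInfinityType (fun _ ↦ 1) (fun _ ↦ 0)) (heq : IsHeckeConjEquivariant c φ)
    (P : Finset ℕ) :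
    Set.Finite {ρ : HeckeCharacter K | ρ ∈ anticyclotomicTwistFamily c P ∧
      ¬ (CentralValueNeZero (φ * ρ) ∨ HasSimpleCentralZero (φ * ρ))} := by
  refine (hR K hK c hc φ hφ heq P).subset fun ρ ⟨hρ, hno⟩ ↦ ⟨hρ, fun hd ↦ hno ?_⟩
  rcases hW K hK c hc φ hφ heq ρ hρ.1 hρ.2.1 with h1 | h2
  · exact Or.inl (hd.1 h1)
  · exact Or.inr (hd.2 h2)

/-- **The family splits by sign, and each half is generically as predicted.** Granted both facts,
every `ρ ∈ X_P` has `W(φρ) = 1` or `W(φρ) = −1`, and: all but finitely many with `W = 1` have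
`L(1, φρ) ≠ 0`; all but finitely many with `W = −1` have a simple zero at `s = 1`.
[cite: Jia2026ActaArith, Thm. 1 with §1] -/
theorem sign_cases_and_finite (hR : RohrlichJia_centralOrder_anticyclotomicTwists)
    (hW : hecke_centralRootNumber_anticyclotomicTwists) (hK : IsImaginaryQuadratic K)
    {c : K ≃ₐ[ℚ] K} (hc : c ≠ 1) {φ : HeckeCharacter K}
    (hφ : φ.HasInfinityType (fun _ ↦ 1) (fun _ ↦ 0)) (heq : IsHeckeConjEquivariant c φ)
    (P : Finset ℕ) :
    (∀ ρ ∈ anticyclotomicTwistFamily c P,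
        IsCentralRootNumber (φ * ρ) 1 ∨ IsCentralRootNumber (φ * ρ) (-1)) ∧
      Set.Finite {ρ : HeckeCharacter K | ρ ∈ anticyclotomicTwistFamily c P ∧
        IsCentralRootNumber (φ * ρ) 1 ∧ ¬ CentralValueNeZero (φ * ρ)} ∧
      Set.Finite {ρ : HeckeCharacter K | ρ ∈ anticyclotomicTwistFamily c P ∧
        IsCentralRootNumber (φ * ρ) (-1) ∧ ¬ HasSimpleCentralZero (φ * ρ)} :=
  ⟨fun ρ hρ ↦ hW K hK c hc φ hφ heq ρ hρ.1 hρ.2.1,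
    (finite_signPlus_and_signMinus hR hK hc hφ heq P).1,
    (finite_signPlus_and_signMinus hR hK hc hφ heq P).2⟩

end RohrlichJia_centralOrder_anticyclotomicTwists

/-! ### Soundness of the root-number predicate (proved): `W² = 1` and `W` is unique

The docstring of `IsCentralRootNumber` (in `RohrlichAnticyclotomicNonvanishing.lean`) asserts that,
although the conductor constant `B` is quantified existentially, the predicate pins down the printed
root number as soon as `L(s, χ) ≢ 0` on the half-plane of convergence. The two theorems below make
this a kernel fact: under `∃ s₀, re s₀ > 3/2 ∧ L(s₀, χ) ≠ 0`, any `W` with `IsCentralRootNumber χ W`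
satisfies `W² = 1`, and two such `W` coincide (identity theorem for entire functions: if
`Γ(s)B₁^s L` and `Γ(s)B₂^s L` satisfy the equations with signs `W₁`, `W₂`, then
`(B₂/B₁)^s − W₁W₂(B₂/B₁)^{2−s}` annihilates the entire function `Λ₁ ≢ 0`, hence vanishes
identically; at `s = 1` this gives `W₁W₂ = 1`). -/

section Soundness

variable {K : Type} [Field K] [NumberField K]

/-- `Γ(s) B^s ≠ 0` for `re s > 0` and `B > 0`. [folklore] -/
private theorem gamma_mul_cpow_ne_zero {B : ℝ} (hB : 0 < B) {s : ℂ} (hs : 0 < s.re) :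
    Complex.Gamma s * (B : ℂ) ^ s ≠ 0 := by
  refine mul_ne_zero (Complex.Gamma_ne_zero_of_re_pos hs) ?_
  rw [Complex.cpow_def_of_ne_zero (by exact_mod_cast hB.ne')]
  exact Complex.exp_ne_zero _

/-- **The sign squares to one.** If `W` is a central root number of `χ` in the sense of
`IsCentralRootNumber` and `L(s, χ)` does not vanish identically on `re s > 3/2`, then `W² = 1`
(apply `Λ(s) = WΛ(2−s)` twice at a point where `Λ ≠ 0`). Jia 2026, §1: "the root number
`W(χ) = 1` or `−1`". [cite: Jia2026ActaArith, §1 and §2 (4)–(5)] -/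
theorem IsCentralRootNumber.sq_eq_one {χ : HeckeCharacter K} {W : ℂ} (h : IsCentralRootNumber χ W)
    (hL : ∃ s : ℂ, 3 / 2 < s.re ∧ heckeLFunction χ s ≠ 0) : W ^ 2 = 1 := by
  obtain ⟨B, hB, Λ, -, hagree, hFE⟩ := h
  obtain ⟨s₀, hs₀, hL0⟩ := hL
  have hΛ0 : Λ s₀ ≠ 0 := by
    rw [hagree s₀ hs₀]
    exact mul_ne_zero (gamma_mul_cpow_ne_zero hB (by linarith)) hL0
  have h2 : Λ s₀ = W ^ 2 * Λ s₀ := by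
    calc Λ s₀ = W * Λ (2 - s₀) := hFE s₀
      _ = W * (W * Λ (2 - (2 - s₀))) := by rw [hFE (2 - s₀)]
      _ = W ^ 2 * Λ s₀ := by rw [sub_sub_cancel]; ring
  exact mul_right_cancel₀ hΛ0 (by rw [one_mul]; exact h2.symm)

/-- **`W ∈ {1, −1}`.** [cite: Jia2026ActaArith, §1 ("the root number W(χ) = 1 or −1")] -/
theorem IsCentralRootNumber.eq_one_or_eq_neg_one {χ : HeckeCharacter K} {W : ℂ}
    (h : IsCentralRootNumber χ W) (hL : ∃ s : ℂ, 3 / 2 < s.re ∧ heckeLFunction χ s ≠ 0) :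
    W = 1 ∨ W = -1 := by
  have hsq := h.sq_eq_one hL
  have hmul : (W - 1) * (W + 1) = 0 := by linear_combination hsq
  rcases mul_eq_zero.1 hmul with h1 | h1
  · exact Or.inl (by linear_combination h1)
  · exact Or.inr (by linear_combination h1)

/-- **Uniqueness of the root number.** Two central root numbers of the same `χ` (possibly
witnessed by different constants `B₁`, `B₂` and continuations `Λ₁`, `Λ₂`) coincide, provided
`L(s, χ) ≢ 0` on `re s > 3/2`: the implicit quantification of `B = (2π)⁻¹(|d_K| N𝔣(χ))^{1/2}` in
`IsCentralRootNumber` loses nothing (module docstring of `RohrlichAnticyclotomicNonvanishing.lean`,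
"Transcription", last item). [cite: Jia2026ActaArith, §2 (3)–(5)] -/
theorem IsCentralRootNumber.unique {χ : HeckeCharacter K} {W₁ W₂ : ℂ}
    (h₁ : IsCentralRootNumber χ W₁) (h₂ : IsCentralRootNumber χ W₂)
    (hL : ∃ s : ℂ, 3 / 2 < s.re ∧ heckeLFunction χ s ≠ 0) : W₁ = W₂ := by
  have hsq : W₁ ^ 2 = 1 := h₁.sq_eq_one hL
  obtain ⟨B₁, hB₁, Λ₁, hd₁, ha₁, hFE₁⟩ := h₁
  obtain ⟨B₂, hB₂, Λ₂, hd₂, ha₂, hFE₂⟩ := h₂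
  obtain ⟨s₀, hs₀, hL0⟩ := hL
  set r : ℝ := B₂ / B₁ with hr
  have hr0 : 0 < r := div_pos hB₂ hB₁
  have hrC : (r : ℂ) ≠ 0 := by exact_mod_cast hr0.ne'
  have hcpow : ∀ s : ℂ, (B₂ : ℂ) ^ s = (r : ℂ) ^ s * (B₁ : ℂ) ^ s := by
    intro s
    have hB : (B₂ : ℝ) = r * B₁ := by rw [hr]; field_simp
    rw [hB, Complex.ofReal_mul, Complex.mul_cpow_ofReal_nonneg hr0.le hB₁.le]
  have hhalf : ∀ s : ℂ, 3 / 2 < s.re → Λ₂ s = (r : ℂ) ^ s * Λ₁ s := by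
    intro s hs
    rw [ha₂ s hs, ha₁ s hs, hcpow s]; ring
  have hg_diff : Differentiable ℂ (fun s : ℂ ↦ (r : ℂ) ^ s) :=
    fun s ↦ differentiableAt_id.const_cpow (Or.inl hrC)
  -- `Λ₂ = r^s Λ₁` everywhere (identity theorem)
  have hall : ∀ s : ℂ, Λ₂ s = (r : ℂ) ^ s * Λ₁ s := by
    have hA : AnalyticOnNhd ℂ Λ₂ Set.univ := hd₂.differentiableOn.analyticOnNhd isOpen_univ
    have hB : AnalyticOnNhd ℂ (fun s ↦ (r : ℂ) ^ s * Λ₁ s) Set.univ :=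
      (hg_diff.mul hd₁).differentiableOn.analyticOnNhd isOpen_univ
    have hopen : IsOpen {s : ℂ | 3 / 2 < s.re} := isOpen_lt continuous_const Complex.continuous_re
    have hmem : (2 : ℂ) ∈ {s : ℂ | 3 / 2 < s.re} := by
      show (3 : ℝ) / 2 < (2 : ℂ).re
      norm_num
    have hev : Λ₂ =ᶠ[nhds (2 : ℂ)] fun s ↦ (r : ℂ) ^ s * Λ₁ s := by
      filter_upwards [hopen.mem_nhds hmem] with s hs using hhalf s hs
    have key := hA.eqOn_of_preconnected_of_eventuallyEq hB isPreconnected_univ (Set.mem_univ _) hev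
    exact fun s ↦ key (Set.mem_univ s)
  have hΛ₁0 : Λ₁ s₀ ≠ 0 := by
    rw [ha₁ s₀ hs₀]
    exact mul_ne_zero (gamma_mul_cpow_ne_zero hB₁ (by linarith)) hL0
  -- the entire function `r^s − W₁W₂ r^{2−s}` annihilates `Λ₁`
  have hkill : ∀ s : ℂ, ((r : ℂ) ^ s - W₁ * W₂ * (r : ℂ) ^ (2 - s)) * Λ₁ s = 0 := by
    intro s
    have e1 : Λ₁ (2 - s) = W₁ * Λ₁ s := by
      have := hFE₁ (2 - s)
      rwa [sub_sub_cancel] at this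
    have e2 : Λ₂ s = W₂ * Λ₂ (2 - s) := hFE₂ s
    rw [hall s, hall (2 - s), e1] at e2
    linear_combination e2
  have hh : ∀ s : ℂ, (r : ℂ) ^ s - W₁ * W₂ * (r : ℂ) ^ (2 - s) = 0 := by
    have hhd : Differentiable ℂ (fun s : ℂ ↦ (r : ℂ) ^ s - W₁ * W₂ * (r : ℂ) ^ (2 - s)) := by
      refine hg_diff.sub ((differentiable_const _).mul fun s ↦ ?_)
      exact ((differentiableAt_const _).sub differentiableAt_id).const_cpow (Or.inl hrC)
    have hA : AnalyticOnNhd ℂ (fun s : ℂ ↦ (r : ℂ) ^ s - W₁ * W₂ * (r : ℂ) ^ (2 - s)) Set.univ :=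
      hhd.differentiableOn.analyticOnNhd isOpen_univ
    have hne : ∀ᶠ s in nhds s₀, Λ₁ s ≠ 0 := hd₁.continuous.continuousAt.eventually_ne hΛ₁0
    have hev : (fun s : ℂ ↦ (r : ℂ) ^ s - W₁ * W₂ * (r : ℂ) ^ (2 - s)) =ᶠ[nhds s₀] 0 := by
      filter_upwards [hne] with s hs
      exact (mul_eq_zero.1 (hkill s)).resolve_right hs
    have key := hA.eqOn_zero_of_preconnected_of_eventuallyEq_zero isPreconnected_univ
      (Set.mem_univ s₀) hev
    exact fun s ↦ key (Set.mem_univ s)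
  -- evaluate at `s = 1`
  have h1 := hh 1
  rw [show (2 : ℂ) - 1 = 1 by norm_num, Complex.cpow_one] at h1
  have hW : W₁ * W₂ = 1 := by
    have h1' : (1 - W₁ * W₂) * (r : ℂ) = 0 := by linear_combination h1
    have := (mul_eq_zero.1 h1').resolve_right hrC
    linear_combination -this
  have hW₁ : W₁ ≠ 0 := by
    rintro rfl
    norm_num at hsq
  have hWW : W₁ * W₂ = W₁ * W₁ := by rw [hW, ← sq, hsq]
  exact (mul_left_cancel₀ hW₁ hWW).symm

/-- Hence on the family `X` (granted Hecke's functional equation) the root number is WELL DEFINED: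
`IsCentralRootNumber (φρ) 1` and `IsCentralRootNumber (φρ) (−1)` are mutually exclusive as soon as
`L(s, φρ) ≢ 0` on `re s > 3/2`, so `RohrlichDichotomy (φρ)` asserts exactly one of its two clauses.
[cite: Jia2026ActaArith, §1 and Thm. 1] -/
theorem IsCentralRootNumber.not_one_and_neg_one {χ : HeckeCharacter K}
    (hL : ∃ s : ℂ, 3 / 2 < s.re ∧ heckeLFunction χ s ≠ 0) :
    ¬ (IsCentralRootNumber χ 1 ∧ IsCentralRootNumber χ (-1)) := by
  rintro ⟨h₁, h₂⟩
  have := h₁.unique h₂ hL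
  norm_num at this

end Soundness


end Literature.NumberTheory.EllipticCurves
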